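import Summits.HubbardSuperconductivity.HubbardSuperconductivity.Theses.WeakCouplingBCS
import Literature.MathematicalPhysics.QuantumLattice.PairCorrelationsProofs
import Literature.MathematicalPhysics.QuantumLattice.ApproximateEigenvectorLemmas
import Literature.MathematicalPhysics.QuantumLattice.HubbardWave0PosSemidefProofs
import Literature.MathematicalPhysics.QuantumLattice.HubbardRingPerronFrobeniusProofs
import Literature.Barriers.HubbardSuperconductivity.PureModelStripeCompetitionProofs

/-!
# Crux `WcbcsSsbToTorusLRO` (item `stmt-HubbardSuperconductivity-2009`): the summit matrix at `(U, δ)` in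
UNIFORM-FLOOR form — negative-side support from the standing disprover (generation 4), file 1 of 4

Route `WeakCouplingBCS`, crux rank 2 (`… → HasDWaveOrder U μ → HasDWavePairFieldLROAt U δ`). The conclusion
`HasDWavePairFieldLROAt U δ` quantifies over SEQUENCES of normalised `(N_L, S^z = 0)` sector ground states of
`hubbardTorus 2 L 1 U` (`N_L = 2⌊(1-δ)L²/2⌋`) and asks for a positive `liminf` of the box-averaged `d`-wave pair
correlation along even sides. This file proves the equivalent FLOOR form consumed by the dissection of the
lead's promoted stub `stub_facePurityChord` (file 3, `FacePurityDissection.lean`):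

* `hasDWavePairFieldLROAt_iff_floor` (`δ ≥ 0`):
  `HasDWavePairFieldLROAt U δ ↔ ∃ a > 0, ∀ᶠ k, ∀ ψ` normalised ground state of `hubbardTorus 2 (2k+2) 1 U` in the
  sector `(N_{2k+2}, 0)`, `a·(2k+2)⁴ ≤ re⟨ψ, P†P ψ⟩` (`P = pairField dWaveFormFactor (2k+2) = √2 Δ_d`).
  Direction `⇐` is the finite-volume kernel `evenLRO_of_eventually_le`; direction `⇒` runs the matrix on a
  NEAR-MINIMISING admissible sequence chosen side by side through `sInf` over the non-empty, bounded-below set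
  of ground-state pair orders (`exists_nearMin_groundState`) — no compactness.

The same normal form in `∃ L₀`-shape (for `δ ≥ -1`) is the tree's
`Summit.HubbardSuperconductivity.TwTipContinuation.Negative.summitMatrix_iff_everyGSOrder` (route ThermalWedge,
`Theorems/TwTipContinuation/Negative/TipNormalForm.lean`); it is re-derived here in the `∀ᶠ k`-shape the
companion files consume, so that this chain imports no other route's Theses. Folklore bookkeeping over the
finite-dimensional variational principle (Tasaki 2020 §2.1–2.2) and Friedli–Velenik 2017 §3.7.2 (LRO as a
liminf); no definitions are introduced (all statements on the literal route terms). Workfile: `Cruxes/WcbcsSsbToTorusLRO/Disproof.lean`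
§K, §13, §14.
-/

noncomputable section

namespace Summit.HubbardSuperconductivity.WcbcsSsbToTorusLRO.Negative

open Matrix Literature.MathematicalPhysics.QuantumLattice Literature.Barriers.HubbardSuperconductivity
open Filter Set
open scoped Matrix ComplexOrder Matrix.Norms.L2Operator
open _root_.Topology

/-! ### The finite-volume kernel: an eventual floor gives even-side long-range order -/

section Kernel

variable (g : Literature.Probability.LatticeModels.Site 2 → ℝ)

/-- A priori bound `re⟨ψ, P_g†P_g ψ⟩ ≤ C_g² (L+1)⁴` for a normalised state. [folklore] -/
theorem re_expect_pairField_le (ψ : ∀ L, Fock (Orb (FermionTorus 2 L))) (L : ℕ)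
    (hψ : star (ψ (L + 1)) ⬝ᵥ ψ (L + 1) = 1) :
    (expect ((pairField g (L + 1))ᴴ * pairField g (L + 1)) (ψ (L + 1))).re ≤
      (∑ e ∈ insert (0 : Literature.Probability.LatticeModels.Site 2) Literature.MathematicalPhysics.QuantumLattice.unitSteps, ‖((g e / Real.sqrt 2 : ℝ) : ℂ)‖ * 2) ^ 2 * ((L + 1 : ℕ) : ℝ) ^ 4 := by
  rw [← sum_pairFieldCorr_succ]
  calc ∑ x : Literature.Probability.LatticeModels.TorusSite 2 (L + 1), ∑ y, pairFieldCorr g ψ (L + 1) x y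
      ≤ ∑ x : Literature.Probability.LatticeModels.TorusSite 2 (L + 1),
          ∑ y : Literature.Probability.LatticeModels.TorusSite 2 (L + 1), (∑ e ∈ insert (0 : Literature.Probability.LatticeModels.Site 2) Literature.MathematicalPhysics.QuantumLattice.unitSteps, ‖((g e / Real.sqrt 2 : ℝ) : ℂ)‖ * 2) ^ 2 :=
        Finset.sum_le_sum fun x _ => Finset.sum_le_sum fun y _ => pairFieldCorr_succ_le g ψ L hψ x y
    _ = (∑ e ∈ insert (0 : Literature.Probability.LatticeModels.Site 2) Literature.MathematicalPhysics.QuantumLattice.unitSteps, ‖((g e / Real.sqrt 2 : ℝ) : ℂ)‖ * 2) ^ 2 * ((L + 1 : ℕ) : ℝ) ^ 4 := by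
        simp only [Finset.sum_const, Finset.card_univ, Fintype.card_pi, ZMod.card,
          Finset.prod_const, Fintype.card_fin]
        push_cast
        ring

/-- **Even-side LRO from an eventual floor**: normalisation and `a·(2k+2)⁴ ≤ re⟨ψ_{2k+2}, P_g†P_g ψ_{2k+2}⟩`
eventually, `a > 0`, give `HasLongRangeOrder` of the pulled-back pair correlation along even sides. [folklore] -/
theorem evenLRO_of_eventually_le (ψ : ∀ L, Fock (Orb (FermionTorus 2 L))) {a : ℝ} (ha : 0 < a)
    (hnorm : ∀ᶠ k : ℕ in atTop, star (ψ (2 * k + 1 + 1)) ⬝ᵥ ψ (2 * k + 1 + 1) = 1)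
    (hlow : ∀ᶠ k : ℕ in atTop, a * ((2 * k + 1 + 1 : ℕ) : ℝ) ^ 4 ≤
      (expect ((pairField g (2 * k + 1 + 1))ᴴ * pairField g (2 * k + 1 + 1))
        (ψ (2 * k + 1 + 1))).re) :
    Literature.Probability.LatticeModels.HasLongRangeOrder
      (fun k => Literature.Probability.LatticeModels.halfOpenBox 2 (2 * k))
      (fun k => torusPullback (pairFieldCorr g ψ) (2 * k)) := by
  unfold Literature.Probability.LatticeModels.HasLongRangeOrder
  rw [← Filter.liminf_nat_add _ 1]
  have key : ∀ k : ℕ,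
      (∑ x ∈ Literature.Probability.LatticeModels.halfOpenBox 2 (2 * (k + 1)),
        ∑ y ∈ Literature.Probability.LatticeModels.halfOpenBox 2 (2 * (k + 1)),
          torusPullback (pairFieldCorr g ψ) (2 * (k + 1)) x y) /
        ((Literature.Probability.LatticeModels.halfOpenBox 2 (2 * (k + 1))).card : ℝ) ^ 2 =
      (expect ((pairField g (2 * k + 1 + 1))ᴴ * pairField g (2 * k + 1 + 1))
          (ψ (2 * k + 1 + 1))).re / ((2 * k + 1 + 1 : ℕ) : ℝ) ^ 4 := by
    intro k
    rw [show 2 * (k + 1) = 2 * k + 1 + 1 by ring]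
    exact torusLROSeq_pairFieldCorr_succ g ψ (2 * k + 1)
  simp only [key]
  have hpos : ∀ k : ℕ, (0 : ℝ) < ((2 * k + 1 + 1 : ℕ) : ℝ) ^ 4 := fun k => by positivity
  refine lt_of_lt_of_le ha (le_liminf_of_le ?_ ?_)
  · refine isCoboundedUnder_ge_of_eventually_le _ (x := (∑ e ∈ insert (0 : Literature.Probability.LatticeModels.Site 2) Literature.MathematicalPhysics.QuantumLattice.unitSteps, ‖((g e / Real.sqrt 2 : ℝ) : ℂ)‖ * 2) ^ 2) ?_
    filter_upwards [hnorm] with k hk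
    rw [div_le_iff₀ (hpos k)]
    exact re_expect_pairField_le g ψ (2 * k + 1) hk
  · filter_upwards [hlow] with k hk
    rwa [le_div_iff₀ (hpos k)]

end Kernel

/-! ### Sector ground states exist; near-minimisers of the pair order exist -/

/-- Normalised ground states of the source-free torus exist in `(2n, S^z = 0)` for `n ≤ L²`
(tree `szSector_groundState`; `|Λ_L| = L²`). [folklore] -/
theorem exists_unit_groundStateInSector (L : ℕ) (U : ℝ) {n : ℕ} (hn : n ≤ L ^ 2) :
    ∃ ψ : Fock (Orb (FermionTorus 2 L)), star ψ ⬝ᵥ ψ = 1 ∧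
      IsGroundStateInSector (hubbardTorus 2 L 1 U) (2 * n) 0 ψ := by
  classical
  have hcard : Fintype.card (FermionTorus 2 L) = L ^ 2 := by
    change Fintype.card (Fin 2 → Fin L) = L ^ 2
    rw [Fintype.card_fun, Fintype.card_fin, Fintype.card_fin]
  have hn' : n ≤ Fintype.card (FermionTorus 2 L) := by rwa [hcard]
  obtain ⟨⟨ψ, hψ⟩, -⟩ := szSector_groundState (fermionTorusGraph 2 L) 1 U hn'
  obtain ⟨c, hc0, hc1⟩ := exists_smul_unit hψ.2.1
  exact ⟨c • ψ, hc1, isGroundStateInSector_smul hψ hc0⟩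

/-- `⌊(1-δ)L²/2⌋ ≤ L²` for `δ ≥ 0`. [folklore] -/
theorem halfFilling_floor_le_sq (L : ℕ) {δ : ℝ} (hδ : 0 ≤ δ) : ⌊(1 - δ) * ((L : ℕ) : ℝ) ^ 2 / 2⌋₊ ≤ L ^ 2 := by
  have hx : (1 - δ) * ((L : ℕ) : ℝ) ^ 2 / 2 ≤ ((L ^ 2 : ℕ) : ℝ) := by
    push_cast
    nlinarith [sq_nonneg (L : ℝ)]
  exact (Nat.floor_mono hx).trans (Nat.floor_natCast _).le

/-- `re⟨φ, P†P φ⟩ = ‖Pφ‖² ≥ 0`. [folklore] -/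
theorem re_expect_pairIntensity_nonneg (L : ℕ) [NeZero L] (φ : Fock (Orb (FermionTorus 2 L))) :
    0 ≤ (expect ((pairField dWaveFormFactor L)ᴴ * pairField dWaveFormFactor L) φ).re := by
  rw [PosSemidefTrace.expect_conjTranspose_mul, ← eucNorm_sq]
  positivity

/-- **Near-minimisers**: at every side `L ≥ 1` and for every `ε > 0` there is a normalised sector ground state whose
pair-order density is within `ε` of that of every other one (`δ ≥ 0`: the sector is non-empty; the set of
ground-state pair orders is bounded below by `0`; `sInf` bookkeeping, no compactness). [folklore] -/
theorem exists_nearMin_groundState (L : ℕ) [NeZero L] (U : ℝ) {δ : ℝ} (hδ : 0 ≤ δ) {ε : ℝ} (hε : 0 < ε) :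
    ∃ ψ : Fock (Orb (FermionTorus 2 L)),
      (IsGroundStateInSector (hubbardTorus 2 L 1 U) (2 * ⌊(1 - δ) * ((L : ℕ) : ℝ) ^ 2 / 2⌋₊) 0 ψ ∧ star ψ ⬝ᵥ ψ = 1) ∧
        ∀ φ : Fock (Orb (FermionTorus 2 L)), IsGroundStateInSector (hubbardTorus 2 L 1 U) (2 * ⌊(1 - δ) * ((L : ℕ) : ℝ) ^ 2 / 2⌋₊) 0 φ →
          star φ ⬝ᵥ φ = 1 →
            (expect ((pairField dWaveFormFactor L)ᴴ * pairField dWaveFormFactor L) ψ).re / ((L : ℕ) : ℝ) ^ 4 ≤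
              (expect ((pairField dWaveFormFactor L)ᴴ * pairField dWaveFormFactor L) φ).re / ((L : ℕ) : ℝ) ^ 4 + ε := by
  set S : Set ℝ := (fun φ : Fock (Orb (FermionTorus 2 L)) => (expect ((pairField dWaveFormFactor L)ᴴ * pairField dWaveFormFactor L) φ).re / ((L : ℕ) : ℝ) ^ 4) ''
    {φ | IsGroundStateInSector (hubbardTorus 2 L 1 U) (2 * ⌊(1 - δ) * ((L : ℕ) : ℝ) ^ 2 / 2⌋₊) 0 φ ∧ star φ ⬝ᵥ φ = 1} with hS
  obtain ⟨ψ₀, hψ₀1, hψ₀⟩ := exists_unit_groundStateInSector L U (halfFilling_floor_le_sq L hδ)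
  have hne : S.Nonempty := ⟨_, ψ₀, ⟨hψ₀, hψ₀1⟩, rfl⟩
  have hbdd : BddBelow S := by
    refine ⟨0, ?_⟩
    rintro x ⟨φ, -, rfl⟩
    exact div_nonneg (re_expect_pairIntensity_nonneg L φ) (by positivity)
  obtain ⟨x, ⟨ψ, hψ, rfl⟩, hx⟩ := exists_lt_of_csInf_lt hne (lt_add_of_pos_right (sInf S) hε)
  refine ⟨ψ, hψ, fun φ hφ hφ1 => ?_⟩
  have : sInf S ≤ (expect ((pairField dWaveFormFactor L)ᴴ * pairField dWaveFormFactor L) φ).re / ((L : ℕ) : ℝ) ^ 4 := csInf_le hbdd ⟨φ, ⟨hφ, hφ1⟩, rfl⟩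
  linarith

/-! ### The summit matrix at `(U, δ)` is the uniform floor -/

/-- **Floor ⇒ summit matrix** (the kernel). [folklore] -/
theorem hasDWavePairFieldLROAt_of_floor {U δ : ℝ} (h : (∃ a : ℝ, 0 < a ∧ ∀ᶠ k : ℕ in Filter.atTop, ∀ ψ : Fock (Orb (FermionTorus 2 (2 * k + 1 + 1))),
    IsGroundStateInSector (hubbardTorus 2 (2 * k + 1 + 1) 1 U) (2 * ⌊(1 - δ) * (((2 * k + 1 + 1) : ℕ) : ℝ) ^ 2 / 2⌋₊) 0 ψ → star ψ ⬝ᵥ ψ = 1 →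
      a * ((2 * k + 1 + 1 : ℕ) : ℝ) ^ 4 ≤ (expect ((pairField dWaveFormFactor (2 * k + 1 + 1))ᴴ * pairField dWaveFormFactor (2 * k + 1 + 1)) ψ).re)) : HasDWavePairFieldLROAt U δ := by
  obtain ⟨a, ha, h⟩ := h
  intro N ψ hadm
  refine evenLRO_of_eventually_le dWaveFormFactor ψ ha
    (Eventually.of_forall fun k => (hadm (2 * k + 1 + 1) ⟨k + 1, by ring⟩).2.1) ?_
  filter_upwards [h] with k hk
  obtain ⟨hNL, hnorm, hGS⟩ := hadm (2 * k + 1 + 1) ⟨k + 1, by ring⟩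
  rw [hNL] at hGS
  exact hk (ψ (2 * k + 1 + 1)) hGS hnorm

/-- **Summit matrix ⇒ floor** (`δ ≥ 0`): run the matrix on a near-minimising admissible sequence; its `liminf` is
positive, hence so is, eventually, the pair order of EVERY ground state. [folklore] -/
theorem floor_of_hasDWavePairFieldLROAt {U δ : ℝ} (hδ : 0 ≤ δ) (h : HasDWavePairFieldLROAt U δ) :
    (∃ a : ℝ, 0 < a ∧ ∀ᶠ k : ℕ in Filter.atTop, ∀ ψ : Fock (Orb (FermionTorus 2 (2 * k + 1 + 1))),
    IsGroundStateInSector (hubbardTorus 2 (2 * k + 1 + 1) 1 U) (2 * ⌊(1 - δ) * (((2 * k + 1 + 1) : ℕ) : ℝ) ^ 2 / 2⌋₊) 0 ψ → star ψ ⬝ᵥ ψ = 1 →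
      a * ((2 * k + 1 + 1 : ℕ) : ℝ) ^ 4 ≤ (expect ((pairField dWaveFormFactor (2 * k + 1 + 1))ᴴ * pairField dWaveFormFactor (2 * k + 1 + 1)) ψ).re) := by
  -- a near-minimising admissible sequence (the near-minimality clause only at sides `L ≥ 1`)
  have hch : ∀ L : ℕ, ∃ ψ : Fock (Orb (FermionTorus 2 L)),
      (IsGroundStateInSector (hubbardTorus 2 L 1 U) (2 * ⌊(1 - δ) * ((L : ℕ) : ℝ) ^ 2 / 2⌋₊) 0 ψ ∧ star ψ ⬝ᵥ ψ = 1) ∧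
        ∀ [NeZero L], ∀ φ : Fock (Orb (FermionTorus 2 L)),
          IsGroundStateInSector (hubbardTorus 2 L 1 U) (2 * ⌊(1 - δ) * ((L : ℕ) : ℝ) ^ 2 / 2⌋₊) 0 φ → star φ ⬝ᵥ φ = 1 →
            (expect ((pairField dWaveFormFactor L)ᴴ * pairField dWaveFormFactor L) ψ).re / ((L : ℕ) : ℝ) ^ 4 ≤
              (expect ((pairField dWaveFormFactor L)ᴴ * pairField dWaveFormFactor L) φ).re / ((L : ℕ) : ℝ) ^ 4 + 1 / (((L : ℕ) : ℝ) + 1) := by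
    intro L
    by_cases hL : L = 0
    · subst hL
      obtain ⟨ψ₀, hψ₀1, hψ₀⟩ := exists_unit_groundStateInSector 0 U (halfFilling_floor_le_sq 0 hδ)
      exact ⟨ψ₀, ⟨hψ₀, hψ₀1⟩, fun φ _ _ => absurd rfl (NeZero.ne (0 : ℕ))⟩
    · haveI : NeZero L := ⟨hL⟩
      obtain ⟨ψ, hψ, hmin⟩ := exists_nearMin_groundState L U hδ (show (0:ℝ) < 1 / (((L : ℕ) : ℝ) + 1) by positivity)
      exact ⟨ψ, hψ, fun φ hφ hφ1 => hmin φ hφ hφ1⟩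
  choose ψ hψadm hψmin using hch
  have hadm : ∀ L : ℕ, Even L → (2 * ⌊(1 - δ) * ((L : ℕ) : ℝ) ^ 2 / 2⌋₊) = (2 * ⌊(1 - δ) * ((L : ℕ) : ℝ) ^ 2 / 2⌋₊) ∧ star (ψ L) ⬝ᵥ ψ L = 1 ∧
      IsGroundStateInSector (hubbardTorus 2 L 1 U) (2 * ⌊(1 - δ) * ((L : ℕ) : ℝ) ^ 2 / 2⌋₊) 0 (ψ L) :=
    fun L _ => ⟨rfl, (hψadm L).2, (hψadm L).1⟩
  have hLRO := h (fun L => (2 * ⌊(1 - δ) * ((L : ℕ) : ℝ) ^ 2 / 2⌋₊)) ψ hadm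
  unfold Literature.Probability.LatticeModels.HasLongRangeOrder at hLRO
  rw [← Filter.liminf_nat_add _ 1] at hLRO
  have key : ∀ k : ℕ,
      (∑ x ∈ Literature.Probability.LatticeModels.halfOpenBox 2 (2 * (k + 1)),
        ∑ y ∈ Literature.Probability.LatticeModels.halfOpenBox 2 (2 * (k + 1)),
          torusPullback (pairFieldCorr dWaveFormFactor ψ) (2 * (k + 1)) x y) /
        ((Literature.Probability.LatticeModels.halfOpenBox 2 (2 * (k + 1))).card : ℝ) ^ 2 =
      (expect ((pairField dWaveFormFactor (2 * k + 1 + 1))ᴴ * pairField dWaveFormFactor (2 * k + 1 + 1)) (ψ (2 * k + 1 + 1))).re /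
        ((2 * k + 1 + 1 : ℕ) : ℝ) ^ 4 := by
    intro k
    rw [show 2 * (k + 1) = 2 * k + 1 + 1 by ring]
    exact torusLROSeq_pairFieldCorr_succ dWaveFormFactor ψ (2 * k + 1)
  simp only [key] at hLRO
  set ℓ := liminf (fun k : ℕ => (expect ((pairField dWaveFormFactor (2 * k + 1 + 1))ᴴ * pairField dWaveFormFactor (2 * k + 1 + 1)) (ψ (2 * k + 1 + 1))).re /
    ((2 * k + 1 + 1 : ℕ) : ℝ) ^ 4) atTop with hℓ
  have hev : ∀ᶠ k : ℕ in atTop, ℓ / 2 <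
      (expect ((pairField dWaveFormFactor (2 * k + 1 + 1))ᴴ * pairField dWaveFormFactor (2 * k + 1 + 1)) (ψ (2 * k + 1 + 1))).re / ((2 * k + 1 + 1 : ℕ) : ℝ) ^ 4 :=
    Filter.eventually_lt_of_lt_liminf (by linarith)
      (isBoundedUnder_of_eventually_ge (Eventually.of_forall fun k =>
        div_nonneg (re_expect_pairIntensity_nonneg _ _) (by positivity)))
  obtain ⟨n, hn⟩ := exists_nat_one_div_lt (show 0 < ℓ / 4 by linarith)
  have hev2 : ∀ᶠ k : ℕ in atTop, 1 / (((2 * k + 1 + 1 : ℕ) : ℝ) + 1) ≤ ℓ / 4 := by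
    filter_upwards [Filter.eventually_ge_atTop n] with k hk
    have h1 : (n : ℝ) + 1 ≤ ((2 * k + 1 + 1 : ℕ) : ℝ) + 1 := by
      have : (n : ℝ) ≤ ((2 * k + 1 + 1 : ℕ) : ℝ) := by exact_mod_cast (by omega : n ≤ 2 * k + 1 + 1)
      linarith
    exact (one_div_le_one_div_of_le (by positivity) h1).trans hn.le
  refine ⟨ℓ / 4, by linarith, ?_⟩
  filter_upwards [hev, hev2] with k hk hk2
  intro φ hφ hφ1
  have hmin := hψmin (2 * k + 1 + 1) φ hφ hφ1
  have hpos : (0 : ℝ) < ((2 * k + 1 + 1 : ℕ) : ℝ) ^ 4 := by positivity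
  have hle : ℓ / 4 ≤ (expect ((pairField dWaveFormFactor (2 * k + 1 + 1))ᴴ * pairField dWaveFormFactor (2 * k + 1 + 1)) φ).re / ((2 * k + 1 + 1 : ℕ) : ℝ) ^ 4 := by
    linarith
  rwa [le_div_iff₀ hpos] at hle

/-- **The summit matrix at `(U, δ)` is the uniform floor** (`δ ≥ 0`). [folklore] -/
theorem hasDWavePairFieldLROAt_iff_floor {U δ : ℝ} (hδ : 0 ≤ δ) : HasDWavePairFieldLROAt U δ ↔ (∃ a : ℝ, 0 < a ∧ ∀ᶠ k : ℕ in Filter.atTop, ∀ ψ : Fock (Orb (FermionTorus 2 (2 * k + 1 + 1))),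
    IsGroundStateInSector (hubbardTorus 2 (2 * k + 1 + 1) 1 U) (2 * ⌊(1 - δ) * (((2 * k + 1 + 1) : ℕ) : ℝ) ^ 2 / 2⌋₊) 0 ψ → star ψ ⬝ᵥ ψ = 1 →
      a * ((2 * k + 1 + 1 : ℕ) : ℝ) ^ 4 ≤ (expect ((pairField dWaveFormFactor (2 * k + 1 + 1))ᴴ * pairField dWaveFormFactor (2 * k + 1 + 1)) ψ).re) :=
  ⟨floor_of_hasDWavePairFieldLROAt hδ, hasDWavePairFieldLROAt_of_floor⟩

end Summit.HubbardSuperconductivity.WcbcsSsbToTorusLRO.Negative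

end
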